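import Mathlib

/-!
# `stub_accumulation` is FALSE without the dominance hypothesis (negative-side, crux `MuOrdinaryFamilyRT`)

Target: the registered stub `stub_accumulation` (Stub C) of the line
`Summits/Langlands/Langlands/Cruxes/MuOrdinaryFamilyRT/Lines/weight-blind-lambda-adic-rt.lean`
(crux item stmt-Langlands-13757).  Stub C carries the DOMINANCE hypothesis
`∃ 𝔮 : Ideal R, 𝔮.IsPrime ∧ Ideal.comap (algebraMap Λ R) 𝔮 = ⊥ ∧ ∀ r ∈ 𝔮, x r = 0`
("the component of `Spec R` through `x` dominates `Spec Λ`", the triage's upgrade (β)).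
This file proves that the hypothesis is LOAD-BEARING in the strongest sense: keep every other
hypothesis of Stub C verbatim, weaken dominance only by deleting the conjunct
`Ideal.comap (algebraMap Λ R) 𝔮 = ⊥` (a prime `𝔮 ⊆ ker x` always exists: `ker x` itself), and the
statement becomes false (`stub_accumulation_false_without_dominance`).

Witness.  `Λ = ℤ₃[T]` (a Noetherian integrally closed domain), `R = Λ × ℤ₃` with
`Λ → R, a ↦ (a, a(0))` (finite: generated by the two idempotents), `x = (a, b) ↦ b ∈ ℤ₃ ⊂ ℚ̄₃`
(the point `T ↦ 0` on the SECOND component, which lies over the single weight `T ↦ 0` only),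
`D = {a ↦ a(3^{m+1}) : m ∈ ℕ}` (`ℚ₃`-rational weights accumulating uniformly at `T ↦ 0`:
`‖a(3^{m+1}) − a(0)‖ ≤ 3^{-(m+1)}` since `3^{m+1} ∣ a(3^{m+1}) − a(0)`), `E = ℚ₃ = ⊥`.  A point `y`
of `R` over a weight `T ↦ 3^{m+1} ≠ 0` must kill the idempotent `e = (0, 1)` (if `y e = 1` then
`y` factors through `ℤ₃` and its weight is `T ↦ 0`, but `3^{m+1} ≠ 0`), whereas `x e = 1`: so
`‖y e − x e‖ = 1 > 3⁻¹` and accumulation fails already at level `m = 1`.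

Moral for the lead: the abstract accumulation kernel is worthless without (β); the content of the
line sits in producing the dominating prime `𝔮` for the component of `R_K` through `x_C`.
Sorry-free; imports Mathlib only (the statement is pure commutative algebra + 3-adic analysis).
-/

set_option linter.dupNamespace false -- project-wide option (lakefile weak.linter.dupNamespace); `Summit.Langlands.Langlands` is the mandated namespace

namespace Summit.Langlands.Langlands.Theorems.MuOrdinaryFamilyRT.Negative

open Polynomial


/-- `‖ι₀ z‖ = ‖z‖ ≤ 1`. [folklore] -/
theorem norm_iota0 (z : ℤ_[3]) :
    ‖(RingHom.comp (algebraMap ℚ_[3] (PadicAlgCl 3)) PadicInt.Coe.ringHom) z‖ = ‖z‖ := by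
  change ‖((z : ℚ_[3]) : PadicAlgCl 3)‖ = ‖z‖
  rw [PadicAlgCl.norm_extends, PadicInt.padic_norm_e_of_padicInt]

/-- `‖ι₀ z‖ ≤ 1`. [folklore] -/
theorem norm_iota0_le_one (z : ℤ_[3]) :
    ‖(RingHom.comp (algebraMap ℚ_[3] (PadicAlgCl 3)) PadicInt.Coe.ringHom) z‖ ≤ 1 := by
  rw [norm_iota0]; exact PadicInt.norm_le_one z

/-- `ι₀ z ∈ ℚ₃ = ⊥ ⊆ ℚ̄₃`. [folklore] -/
theorem iota0_mem_bot (z : ℤ_[3]) :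
    (RingHom.comp (algebraMap ℚ_[3] (PadicAlgCl 3)) PadicInt.Coe.ringHom) z ∈
      (⊥ : IntermediateField ℚ_[3] (PadicAlgCl 3)) :=
  IntermediateField.mem_bot.mpr ⟨(z : ℚ_[3]), rfl⟩

/-- **Stub C without dominance is false.**  The statement below is `stub_accumulation` verbatim
except that the conjunct `Ideal.comap (algebraMap Λ R) 𝔮 = ⊥` has been deleted from the
dominance hypothesis. [folklore] -/
theorem stub_accumulation_false_without_dominance :
    ¬ ∀ (Λ R : Type) [CommRing Λ] [IsDomain Λ] [IsNoetherianRing Λ] [IsIntegrallyClosed Λ]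
      [CommRing R] [Algebra Λ R] [Module.Finite Λ R]
      (x : R →+* PadicAlgCl 3) (D : Set (Λ →+* PadicAlgCl 3))
      (E : IntermediateField ℚ_[3] (PadicAlgCl 3)), FiniteDimensional ℚ_[3] E →
      (∃ 𝔮 : Ideal R, 𝔮.IsPrime ∧ ∀ r ∈ 𝔮, x r = 0) →
      (∀ a : Λ, ‖x (algebraMap Λ R a)‖ ≤ 1) →
      (∀ κ ∈ D, ∀ a : Λ, κ a ∈ E ∧ ‖κ a‖ ≤ 1) →
      (∀ m : ℕ, ∃ κ ∈ D, ∀ a : Λ, ‖κ a - x (algebraMap Λ R a)‖ ≤ ((3 : ℝ)⁻¹) ^ m) →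
    ∀ m : ℕ, ∃ y : R →+* PadicAlgCl 3, y.comp (algebraMap Λ R) ∈ D ∧
      ∀ r : R, ‖y r - x r‖ ≤ ((3 : ℝ)⁻¹) ^ m := by
  intro h
  -- the canonical embedding ι : ℤ₃ → ℚ₃ → ℚ̄₃
  set ι : ℤ_[3] →+* PadicAlgCl 3 :=
    RingHom.comp (algebraMap ℚ_[3] (PadicAlgCl 3)) PadicInt.Coe.ringHom with hι
  -- Λ = ℤ₃[T], R = Λ × ℤ₃ with the weight `T ↦ 0` on the second factor
  letI alg : Algebra ℤ_[3][X] ℤ_[3] := (Polynomial.evalRingHom (0 : ℤ_[3])).toAlgebra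
  have halg : ∀ a : ℤ_[3][X], algebraMap ℤ_[3][X] ℤ_[3] a = a.eval 0 := fun a => rfl
  haveI : Module.Finite ℤ_[3][X] ℤ_[3] :=
    Module.Finite.of_surjective (Algebra.linearMap ℤ_[3][X] ℤ_[3]) fun b =>
      ⟨Polynomial.C b, by simp [Algebra.linearMap_apply, halg]⟩
  -- the point x, the weights κ m, the set D
  let x : ℤ_[3][X] × ℤ_[3] →+* PadicAlgCl 3 := RingHom.comp ι (RingHom.snd ℤ_[3][X] ℤ_[3])
  let κ : ℕ → (ℤ_[3][X] →+* PadicAlgCl 3) := fun m =>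
    RingHom.comp ι (Polynomial.evalRingHom ((3 : ℤ_[3]) ^ (m + 1)))
  let D : Set (ℤ_[3][X] →+* PadicAlgCl 3) := Set.range κ
  have hxalg : ∀ a : ℤ_[3][X], x (algebraMap ℤ_[3][X] (ℤ_[3][X] × ℤ_[3]) a) = ι (a.eval 0) :=
    fun a => rfl
  have hκ : ∀ m a, κ m a = ι (a.eval ((3 : ℤ_[3]) ^ (m + 1))) := fun m a => rfl
  -- apply the would-be accumulation statement
  have H := h ℤ_[3][X] (ℤ_[3][X] × ℤ_[3]) x D ⊥ inferInstance
    ⟨RingHom.ker x, RingHom.ker_isPrime x, fun r hr => hr⟩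
    (fun a => by rw [hxalg]; exact norm_iota0_le_one _)
    (by
      rintro κ' ⟨m, rfl⟩ a
      exact ⟨by rw [hκ]; exact iota0_mem_bot _, by rw [hκ]; exact norm_iota0_le_one _⟩)
    (by
      intro m
      refine ⟨κ m, ⟨m, rfl⟩, fun a => ?_⟩
      rw [hκ, hxalg, ← map_sub, norm_iota0]
      obtain ⟨w, hw⟩ := Polynomial.sub_dvd_eval_sub ((3 : ℤ_[3]) ^ (m + 1)) 0 a
      rw [sub_zero] at hw
      have h3 : ‖(3 : ℤ_[3])‖ = (3 : ℝ)⁻¹ := by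
        have := PadicInt.norm_p (p := 3)
        simpa using this
      rw [hw, norm_mul, norm_pow, h3]
      calc (3 : ℝ)⁻¹ ^ (m + 1) * ‖w‖ ≤ (3 : ℝ)⁻¹ ^ (m + 1) * 1 := by
            gcongr; exact PadicInt.norm_le_one w
        _ ≤ (3 : ℝ)⁻¹ ^ m := by
            rw [mul_one]
            exact pow_le_pow_of_le_one (by norm_num) (by norm_num) (Nat.le_succ m))
    1
  obtain ⟨y, ⟨m, hm⟩, hy⟩ := H
  -- the idempotent of the second factor
  set e : ℤ_[3][X] × ℤ_[3] := (0, 1) with he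
  have hxe : x e = 1 := by simp [x, e]
  have hye : y e = 0 ∨ y e = 1 := by
    have h2 : y e * y e = y e := by rw [← map_mul]; simp [e]
    rcases mul_eq_zero.mp (show y e * (y e - 1) = 0 by rw [mul_sub, mul_one, h2, sub_self])
      with h0 | h1
    · exact Or.inl h0
    · exact Or.inr (sub_eq_zero.mp h1)
  rcases hye with h0 | h1
  · -- y e = 0: far from x e = 1
    have := hy e
    rw [h0, hxe, zero_sub, norm_neg, norm_one, pow_one] at this
    norm_num at this
  · -- y e = 1: y factors through ℤ₃, so its weight is T ↦ 0, contradicting 3^{m+1} ≠ 0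
    have h10 : y ((1 : ℤ_[3][X]), (0 : ℤ_[3])) = 0 := by
      have : ((1 : ℤ_[3][X]), (0 : ℤ_[3])) = 1 - e := by
        rw [he]; ext <;> simp
      rw [this, map_sub, map_one, h1, sub_self]
    have hX0 : y (algebraMap ℤ_[3][X] (ℤ_[3][X] × ℤ_[3]) X) = 0 := by
      have : algebraMap ℤ_[3][X] (ℤ_[3][X] × ℤ_[3]) X = ((X : ℤ_[3][X]), (0 : ℤ_[3])) := by
        rw [Prod.algebraMap_apply, halg, eval_X, Algebra.algebraMap_self, RingHom.id_apply]
      rw [this]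
      have : ((X : ℤ_[3][X]), (0 : ℤ_[3])) = ((X : ℤ_[3][X]), (0 : ℤ_[3])) * ((1 : ℤ_[3][X]), 0) := by
        simp
      rw [this, map_mul, h10, mul_zero]
    have hκX : κ m X = ι ((3 : ℤ_[3]) ^ (m + 1)) := by rw [hκ, eval_X]
    have : (κ m) X = 0 := by rw [hm]; exact hX0
    rw [hκX, map_pow, map_ofNat] at this
    exact absurd this (pow_ne_zero _ (by norm_num))

end Summit.Langlands.Langlands.Theorems.MuOrdinaryFamilyRT.Negative
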